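import Literature.Probability.RandomPlanarGeometry.SAWTiltedFiniteMemory
import HarnessLib

/-!
# Tilted memory-16 certificate, tilt `r = 3/2` (`θ = log r = 0.4055`): `λ̄ = 3.078458`

Topic `Literature/Probability/RandomPlanarGeometry`. One compiled evaluation of
`FiniteMemory.checkW 16 3 2 18470750 1000000 60` (`SAWTiltedFiniteMemory.lean`): the `467 249` states of
the memory-16 Pönitz–Tittmann automaton on `ℤ²`, 60 rounds of weighted integer power iteration with
the letter weights `W(+e₀) = 9`, `W(±e₁) = 6`, `W(-e₀) = 4` (`= 6 · (3/2)^{dx}`), and the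
verified weighted Collatz–Wielandt check with ratio `18470750/1000000`, i.e. the tilted growth rate
`λ̄ = 18470750/(1000000·6) = 3.078458 ≥ λ₁₆(θ = 0.4055)`. By `FiniteMemory.card_sawWords_xEnd_ge_le`:
`#{ω ∈ SAW_n : x(ω_n) ≥ m} ≤ 2⁴¹ · 3.078458ⁿ · (2/3)^m` for all `n`, `m`; with `μ ≥ 2.604`
(`le_connectiveConstant_2604`) the speed threshold of this tilt is `v₀ = log(λ̄/2.604)/θ = 0.4128`.
Axiom: `Lean.ofReduceBool` (`native_decide`, declared `computational`); ≈ 4–5 minutes.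

## References

* H. Duminil-Copin, A. Hammond, *Self-avoiding walk is sub-ballistic*, CMP 324 (2013), Thm 1.1 [DuminilCopinHammond2013].
* A. Pönitz, P. Tittmann, Electron. J. Combin. 7 (2000) R21, §3 [PonitzTittmann2000].
-/

namespace Literature.Probability.RandomPlanarGeometry.SAW.FiniteMemory

/-- The tilted memory-16 certificate with tilt `3/2` evaluates to `true` (ratio `18470750/1000000`).
[cite: PonitzTittmann2000, §3] -/
theorem checkW_16_3_2 : checkW 16 3 2 18470750 1000000 60 = true := by
  native_decide

end Literature.Probability.RandomPlanarGeometry.SAW.FiniteMemory
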